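/-
Copyright (c) 2026 the pub-hodgecm-mathlib formalisation cell (harness21).  Prover seat hodgecm-mathlib-K2E1-p12 (g3), Track B ∕ K2-LIT, h413 = `stmt-HodgeConjecture-24833`,
line `K2_E1_TraceFormulaBeta`, dealer K2E1-plan (g7) ruling (264) «AMENDMENT #3, rung C.1 (α)_τ»: the `K_∞`-TYPE (ω-twisted) edition of ★ F3d-α p860579
`K2E1NormOneTorusFamilyApproxU2.exists_finset_heckeCharacter_family_decomposition` — the input family `ψ` is right-`K'`-EQUIVARIANT by a function `ω : K' → ℂ` with `‖ω‖ ≤ 1`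
(`ψ(g k) = ω(k) ψ(g)`) instead of right-`K'`-invariant, and so are the isotypic pieces `P_χ`; the binder `hα_τ` of the C7_τ chain (K2E1-p10 lineage, CENSUS-GENERAL-LEVEL §B∕§C.1).
-/
import Summits.HodgeConjecture.HodgeConjecture.Theorems.K2E1NormOneTorusFamilyApproxU2          -- ★ α-2b (τ = 1): §3 isotypic pieces (`continuous_isotypicU`, `isotypicU_mul_normOne`, …), `kernel_one_eq`; brings ★ α-0∕α-1∕α-2a∕F3c
import HarnessLib

/-!
# K2·E1 — `K2E1NormOneTorusFamilyApproxKTypeU2` (F3d-α_τ): ISOTYPIC DECOMPOSITION UNDER `C_E¹` of band-limited left-`N(𝔸)B(F)`-invariant, RIGHT-`(K', ω)`-EQUIVARIANT families on `U(1,1)(𝔸_F)`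

Track B ∕ K2-LIT, crux h413 = `stmt-HodgeConjecture-24833`, route `HCCMUnconditional`; cell `hodgecm-mathlib`, squad K2, ENGINE E1, ROADCARD C7 «families», AMENDMENT #3 (general
`(U, τ)` ladder, rung C.1); consumer: the C7_τ HEAD_τ of the K2E1-p10 lineage (binder `hα_τ` = §4 below with `(hc, hBK, hω)` applied).  THEOREMS ONLY (no `def`, no `instance`, no
notation, no named-fact hypothesis, no `sorry`); lane `--supports stmt-HodgeConjecture-24833 --as helper` (count-neutral).  Closes no socket.  Generic quasi-split pair `(F, E, c)` with
`c² = 1`, rank `2` (the CM pair is an instance); `K_∞ ≅ U(1) × U(1)` per real place is abelian, so a `K_∞`-type is a character and the scalar currency `ω : K' → ℂ` (that of ★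
`chiSectionSpace χ K' ω`) is the general one.

THE MATHEMATICS ([MoeglinWaldspurger1995, §II.1.3, §II.1.10]; [Garrett2018, §2.10–§2.11]; [DeitmarEchterhoff2014, Prop. 3.5.2]).  VERBATIM the τ = 1 argument of ★ α-2b: the torus
kernel `Φ(c, g) = ψ(σ(x) g)` of ★ α-1 acts on the LEFT, so it commutes with the right `K'`-action and inherits `Φ(c, g k) = ω(k) Φ(c, g)` (§0); with `‖ω‖ ≤ 1` the reduction
`g = β w k ↦ w` of ★ α-2b §1–§2 still gives EQUICONTINUITY under `C_E¹` and a UNIFORM BOUND (the factor `ω(k)` only shrinks norms); the isotypic pieces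
`P_{χ₀}(g) = ∫_{C_E¹} χ̄₀(c) Φ(c, g) dc` are ★ α-2b §3 verbatim (continuity, `χ₀`-isotypy under norm-one Borel translations, band, bound) and are right-`(K', ω)`-equivariant (§3);
★ α-2a (Fejér for equicontinuous bounded families on the compact abelian group `C_E¹`) and the ★ α-0 dictionary `χ₀ ↦ χ` finish exactly as before (§4 HEAD, clause order of ★ p860579
with the `K'`-clause twisted by `ω` on both sides).  CENSUS (dealer (264)): ★ α-0, ★ α-1 (`exists_torusSection_two`, `exists_kernel`, `kernel_borel_mul`, `kernel_rational_mul`,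
`exists_isCompact_kernel_eq_zero`, `norm_mul_borelHeight_mem_of_kernel_ne_zero`), ★ α-2a (`exists_finset_character_family_approx`) and ★ α-2b §3 are τ-GENERIC and reused BY NAME; only
★ α-1 `kernel_mul_right` and ★ α-2b §1∕§2∕§4 carried the invariance `ψ(h k) = ψ(h)` and get ω-twins here.
* §0 `kernel_mul_right_smul` · §1 `exists_isOpen_forall_kernel_sub_le_kType` · §2 `exists_forall_norm_kernel_le_kType` · §3 `isotypicU_mul_right_kType` ·
  §4 HEAD **`exists_finset_heckeCharacter_family_decomposition_kType`** (`hα_τ`).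
HONEST LABEL: HC_CM is proved only modulo the 7 printed citations (2 remaining named inputs: hLiu418 = `stmt-HodgeConjecture-24832`, h413 = `stmt-HodgeConjecture-24833`) until rung 0
closes; this file is letter-free and closes no socket.
References: [MoeglinWaldspurger1995] §II.1.3, §II.1.10 · [Garrett2018] §2.10–§2.11 · [DeitmarEchterhoff2014] Prop. 3.5.2 · [WeilBNT1967] Ch. IV §4.
-/

set_option autoImplicit false
-- the mandated namespace repeats the single-problem summit's segment (`HodgeConjecture.HodgeConjecture`)
set_option linter.dupNamespace false

noncomputable section

open NumberField IsDedekindDomain Set Filter Topology Function MeasureTheory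
open scoped NNReal
open Literature.NumberTheory.Automorphic Literature.NumberTheory.Automorphic.UnitaryGroup Literature.NumberTheory.GaloisRepresentations
open Summit.HodgeConjecture.HodgeConjecture.Cruxes.H413.K2E1CharacterEisensteinU2Defs Summit.HodgeConjecture.HodgeConjecture.Cruxes.H413.K2E1NormOneIdeleClassRetractionU
  Summit.HodgeConjecture.HodgeConjecture.Cruxes.H413.K2E1NormOneTorusFamilyActionU2 Summit.HodgeConjecture.HodgeConjecture.Cruxes.H413.K2E1CompactAbelianIsotypicApproximationU
  Summit.HodgeConjecture.HodgeConjecture.Cruxes.H413.K2E1CompactAbelianFamilyApproximationU Summit.HodgeConjecture.HodgeConjecture.Cruxes.H413.K2E1NormOneTorusFamilyApproxU2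

namespace Summit.HodgeConjecture.HodgeConjecture.Cruxes.H413.K2E1NormOneTorusFamilyApproxKTypeU2

variable {F E : Type} [Field F] [NumberField F] [Field E] [NumberField E] [Algebra F E] {c : E ≃ₐ[F] E}

/-! ## §0 The torus kernel commutes with right multiplication: `Φ(y, g k) = ω₀ · Φ(y, g)` whenever `ψ(h k) = ω₀ · ψ(h)` -/

/-- **ω-TWIN OF ★ α-1 `kernel_mul_right`**: the kernel `Φ(c, g) = ψ(σ(x) g)` is built by LEFT multiplication, so a right-equivariance `ψ(h k) = ω₀·ψ(h)` (all `h`) passes to every section: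
`Φ(y, g k) = ω₀·Φ(y, g)`. [cite: MoeglinWaldspurger1995, §II.1.3] -/
theorem kernel_mul_right_smul {ψ : (quasiSplit F E c 2).Adelic → ℂ} {σ : ideleGroup E → ↥(torusInBorel F E c 2)}
    {Φ : IdeleClassGroup E → (quasiSplit F E c 2).Adelic → ℂ} (hΦ : ∀ (x : ideleGroup E) (g : (quasiSplit F E c 2).Adelic), Φ (x : IdeleClassGroup E) g = ψ ((σ x).1.1 * g))
    {g k : (quasiSplit F E c 2).Adelic} {ω₀ : ℂ} (hk : ∀ h : (quasiSplit F E c 2).Adelic, ψ (h * k) = ω₀ * ψ h) (y : IdeleClassGroup E) : Φ y (g * k) = ω₀ * Φ y g := by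
  induction y using QuotientGroup.induction_on with
  | H x => rw [hΦ, hΦ, ← mul_assoc, hk]

/-! ## §1 Equicontinuity of the family `{Φ(·, g)}_g` under the norm-one classes (right-`(K', ω)`-equivariant `ψ`, `‖ω‖ ≤ 1`) -/

/-- **EQUICONTINUITY (ω-twisted).**  With `G = B(𝔸_F)·W·K'` (`W` finite), `ψ` right-`(K', ω)`-equivariant with `‖ω‖ ≤ 1` and band-limited (`0 < a`): for `ε > 0` there is an open `u ∋ 1` in
`C_E¹` with `‖Φ(v·y, g) − Φ(y, g)‖ ≤ ε` for all `v ∈ u`, ALL `y ∈ C_E` and ALL `g` (for `g = β w k` the difference is `ω(k)` times the difference at the translate by `[β₀₀]` of the compactly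
supported section `Φ(·, w)`, `w` in the finite `W`; generalized tube lemma ★ F3c). [cite: MoeglinWaldspurger1995, §II.1.3] -/
theorem exists_isOpen_forall_kernel_sub_le_kType {ψ : (quasiSplit F E c 2).Adelic → ℂ}
    (hψU : ∀ (u : adelicUnipotent F E c 2) (g : (quasiSplit F E c 2).Adelic), ψ ((u : (quasiSplit F E c 2).Adelic) * g) = ψ g)
    {K' : Subgroup (quasiSplit F E c 2).Adelic} {ω : ↥K' → ℂ} (hω : ∀ k : ↥K', ‖ω k‖ ≤ 1)
    (hψK : ∀ (g : (quasiSplit F E c 2).Adelic) (k : K'), ψ (g * (k : (quasiSplit F E c 2).Adelic)) = ω k * ψ g)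
    {a b : ℝ≥0} (ha : 0 < a) (hband : ∀ g, ψ g ≠ 0 → a ≤ borelHeight g ∧ borelHeight g ≤ b)
    (hBK : ∃ W : Finset (quasiSplit F E c 2).Adelic, ∀ g, ∃ β ∈ borelAdelic F E c 2, ∃ w ∈ W, ∃ k ∈ K', g = β * w * k)
    {σ : ideleGroup E → ↥(torusInBorel F E c 2)} (hσm : ∀ x y, σ (x * y) = σ x * σ y) (hσ₀ : ∀ x, firstEntryUnit (σ x).1.2 = x)
    (hσt : ∀ t : ↥(torusInBorel F E c 2), σ (firstEntryUnit t.1.2) = t)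
    {Φ : IdeleClassGroup E → (quasiSplit F E c 2).Adelic → ℂ} (hΦ : ∀ (x : ideleGroup E) (g : (quasiSplit F E c 2).Adelic), Φ (x : IdeleClassGroup E) g = ψ ((σ x).1.1 * g))
    (hΦc : Continuous (uncurry Φ)) {ε : ℝ} (hε : 0 < ε) :
    ∃ u : Set ↥(IdeleClassGroup.normOne E), IsOpen u ∧ (1 : ↥(IdeleClassGroup.normOne E)) ∈ u ∧
      ∀ v ∈ u, ∀ (y : IdeleClassGroup E) (g : (quasiSplit F E c 2).Adelic), ‖Φ ((v : IdeleClassGroup E) * y) g - Φ y g‖ ≤ ε := by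
  classical
  haveI : T2Space (IdeleClassGroup E) := IdeleClassGroup.t2Space_ideleClassGroup_holds E
  haveI : CompactSpace ↥(IdeleClassGroup.normOne E) := compactSpace_normOne E
  obtain ⟨W, hW⟩ := hBK
  -- each section `Φ(·, w)` is continuous with compact support
  have hcw : ∀ w : (quasiSplit F E c 2).Adelic, Continuous fun y : IdeleClassGroup E => Φ y w := fun w => hΦc.comp (continuous_id.prodMk continuous_const)
  have hsw : ∀ w : (quasiSplit F E c 2).Adelic, HasCompactSupport fun y : IdeleClassGroup E => Φ y w := fun w => by
    obtain ⟨S, hS, hS0⟩ := exists_isCompact_kernel_eq_zero ha hband hσ₀ hΦ w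
    exact HasCompactSupport.intro hS hS0
  -- tube lemma for each `w`, intersected over the finite `W`
  choose uw huw h1uw hUw using fun w : (quasiSplit F E c 2).Adelic =>
    exists_nhds_one_forall_norm_sub_le (C := ↥(IdeleClassGroup.normOne E)) (hcw w) (hsw w) hε
  refine ⟨⋂ w ∈ W, uw w, isOpen_biInter_finset fun w _ => huw w, mem_iInter₂.2 fun w _ => h1uw w, fun v hv y g => ?_⟩
  obtain ⟨β, hβ, w, hwW, k, hk, rfl⟩ := hW g
  have hv' : v ∈ uw w := mem_iInter₂.1 hv w hwW
  have hk' : ∀ h : (quasiSplit F E c 2).Adelic, ψ (h * k) = ω ⟨k, hk⟩ * ψ h := fun h => hψK h ⟨k, hk⟩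
  rw [kernel_mul_right_smul hΦ hk', kernel_mul_right_smul hΦ hk', kernel_borel_mul hψU hσm hσt hΦ _ hβ, kernel_borel_mul hψU hσm hσt hΦ _ hβ, mul_assoc, ← mul_sub, norm_mul]
  calc ‖ω ⟨k, hk⟩‖ * ‖Φ ((v : IdeleClassGroup E) * (y * (firstEntryUnit hβ : IdeleClassGroup E))) w - Φ (y * (firstEntryUnit hβ : IdeleClassGroup E)) w‖
      ≤ 1 * ‖Φ ((v : IdeleClassGroup E) * (y * (firstEntryUnit hβ : IdeleClassGroup E))) w - Φ (y * (firstEntryUnit hβ : IdeleClassGroup E)) w‖ :=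
        mul_le_mul_of_nonneg_right (hω _) (norm_nonneg _)
    _ ≤ ε := by rw [one_mul]; exact hUw w v hv' (y * (firstEntryUnit hβ : IdeleClassGroup E))

/-! ## §2 A uniform bound -/

/-- **UNIFORM BOUND (ω-twisted)**: `‖Φ(y, g)‖ ≤ M` for all `y, g` (finitely many compactly supported continuous sections up to translation and the factors `ω(k)`, `‖ω‖ ≤ 1`).
[cite: MoeglinWaldspurger1995, §II.1.3] -/
theorem exists_forall_norm_kernel_le_kType {ψ : (quasiSplit F E c 2).Adelic → ℂ}
    (hψU : ∀ (u : adelicUnipotent F E c 2) (g : (quasiSplit F E c 2).Adelic), ψ ((u : (quasiSplit F E c 2).Adelic) * g) = ψ g)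
    {K' : Subgroup (quasiSplit F E c 2).Adelic} {ω : ↥K' → ℂ} (hω : ∀ k : ↥K', ‖ω k‖ ≤ 1)
    (hψK : ∀ (g : (quasiSplit F E c 2).Adelic) (k : K'), ψ (g * (k : (quasiSplit F E c 2).Adelic)) = ω k * ψ g)
    {a b : ℝ≥0} (ha : 0 < a) (hband : ∀ g, ψ g ≠ 0 → a ≤ borelHeight g ∧ borelHeight g ≤ b)
    (hBK : ∃ W : Finset (quasiSplit F E c 2).Adelic, ∀ g, ∃ β ∈ borelAdelic F E c 2, ∃ w ∈ W, ∃ k ∈ K', g = β * w * k)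
    {σ : ideleGroup E → ↥(torusInBorel F E c 2)} (hσm : ∀ x y, σ (x * y) = σ x * σ y) (hσ₀ : ∀ x, firstEntryUnit (σ x).1.2 = x)
    (hσt : ∀ t : ↥(torusInBorel F E c 2), σ (firstEntryUnit t.1.2) = t)
    {Φ : IdeleClassGroup E → (quasiSplit F E c 2).Adelic → ℂ} (hΦ : ∀ (x : ideleGroup E) (g : (quasiSplit F E c 2).Adelic), Φ (x : IdeleClassGroup E) g = ψ ((σ x).1.1 * g))
    (hΦc : Continuous (uncurry Φ)) :
    ∃ M : ℝ, ∀ (y : IdeleClassGroup E) (g : (quasiSplit F E c 2).Adelic), ‖Φ y g‖ ≤ M := by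
  classical
  haveI : T2Space (IdeleClassGroup E) := IdeleClassGroup.t2Space_ideleClassGroup_holds E
  obtain ⟨W, hW⟩ := hBK
  have hcw : ∀ w : (quasiSplit F E c 2).Adelic, Continuous fun y : IdeleClassGroup E => Φ y w := fun w => hΦc.comp (continuous_id.prodMk continuous_const)
  have hsw : ∀ w : (quasiSplit F E c 2).Adelic, HasCompactSupport fun y : IdeleClassGroup E => Φ y w := fun w => by
    obtain ⟨S, hS, hS0⟩ := exists_isCompact_kernel_eq_zero ha hband hσ₀ hΦ w
    exact HasCompactSupport.intro hS hS0
  choose Mw hMw using fun w : (quasiSplit F E c 2).Adelic => (hcw w).bounded_above_of_compact_support (hsw w)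
  refine ⟨∑ w ∈ W, max (Mw w) 0, fun y g => ?_⟩
  obtain ⟨β, hβ, w, hwW, k, hk, rfl⟩ := hW g
  have hk' : ∀ h : (quasiSplit F E c 2).Adelic, ψ (h * k) = ω ⟨k, hk⟩ * ψ h := fun h => hψK h ⟨k, hk⟩
  rw [kernel_mul_right_smul hΦ hk', kernel_borel_mul hψU hσm hσt hΦ _ hβ, norm_mul]
  calc ‖ω ⟨k, hk⟩‖ * ‖Φ (y * (firstEntryUnit hβ : IdeleClassGroup E)) w‖ ≤ 1 * ‖Φ (y * (firstEntryUnit hβ : IdeleClassGroup E)) w‖ :=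
        mul_le_mul_of_nonneg_right (hω _) (norm_nonneg _)
    _ ≤ ∑ w' ∈ W, max (Mw w') 0 := by
        rw [one_mul]
        exact ((hMw w _).trans (le_max_left _ _)).trans (Finset.single_le_sum (fun w' _ => le_max_right (Mw w') 0) hwW)

/-! ## §3 The isotypic pieces are right-`(K', ω)`-equivariant -/

/-- **`P_{χ₀}(g k) = ω(k)·P_{χ₀}(g)`** for the isotypic pieces `P_{χ₀}(g) = ∫_{C_E¹} χ̄₀(v) Φ(v, g) dv` of a right-`(K', ω)`-equivariant `ψ` (§0 under the integral sign).
[cite: MoeglinWaldspurger1995, §II.1.10] -/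
theorem isotypicU_mul_right_kType [MeasurableSpace ↥(IdeleClassGroup.normOne E)] (μC : Measure ↥(IdeleClassGroup.normOne E)) {ψ : (quasiSplit F E c 2).Adelic → ℂ}
    {K' : Subgroup (quasiSplit F E c 2).Adelic} {ω : ↥K' → ℂ} (hψK : ∀ (g : (quasiSplit F E c 2).Adelic) (k : K'), ψ (g * (k : (quasiSplit F E c 2).Adelic)) = ω k * ψ g)
    {σ : ideleGroup E → ↥(torusInBorel F E c 2)} {Φ : IdeleClassGroup E → (quasiSplit F E c 2).Adelic → ℂ}
    (hΦ : ∀ (x : ideleGroup E) (g : (quasiSplit F E c 2).Adelic), Φ (x : IdeleClassGroup E) g = ψ ((σ x).1.1 * g)) (χ₀ : PontryaginDual ↥(IdeleClassGroup.normOne E))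
    (g : (quasiSplit F E c 2).Adelic) (k : ↥K') :
    ∫ v, star ((χ₀ v : Circle) : ℂ) * Φ (v : IdeleClassGroup E) (g * (k : (quasiSplit F E c 2).Adelic)) ∂μC = ω k * ∫ v, star ((χ₀ v : Circle) : ℂ) * Φ (v : IdeleClassGroup E) g ∂μC := by
  simp_rw [kernel_mul_right_smul hΦ (fun h => hψK h k), mul_left_comm _ (ω k)]
  exact integral_const_mul _ _

/-! ## §4 HEAD: the isotypic decomposition of a right-`(K', ω)`-equivariant family, indexed by Hecke characters trivial on the archimedean ray (`hα_τ`; clause order of ★ p860579) -/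

/-- **ISOTYPIC DECOMPOSITION UNDER `C_E¹` OF A BAND-LIMITED LEFT-`N(𝔸)B(F)`-INVARIANT, RIGHT-`(K', ω)`-EQUIVARIANT FAMILY ON `U(1,1)(𝔸_F)`** (`c² = 1`, `G = B(𝔸_F)·W·K'` with `W`
finite, `ω : K' → ℂ` with `‖ω‖ ≤ 1` — e.g. a `K_∞`-type character extended by `1` on an open compact `U_f`).  For `ψ : G → ℂ` continuous, left-`N(𝔸_F)`-invariant, left-`B(F)`-invariant,
right-`(K', ω)`-EQUIVARIANT (`ψ(g k) = ω(k) ψ(g)`), supported in the height band `[a, b]` with `0 < a`, and `ε > 0`: there are finitely many Hecke characters `χ` of `E` TRIVIAL ON THE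
ARCHIMEDEAN RAY, coefficients, and functions `P_χ : G → ℂ` — continuous, right-`(K', ω)`-equivariant, left-`B(F)`-invariant, `χ`-ISOTYPIC under norm-one Borel translations
(`P_χ(b g) = χ(b₀₀) P_χ(g)` when `‖b₀₀‖ = 1`), supported in the same band, bounded — with `‖ψ(g) − Σ_χ coef χ · P_χ(g)‖ ≤ ε` for all `g`.  (`P_χ = ∫_{C_E¹} χ̄₀ Φ(·, g)`, ★ α-1 kernel,
★ α-2a Fejér for families, ★ α-0 dictionary `χ₀ ↦ χ`; the τ = 1 case is ★ p860579.) [cite: MoeglinWaldspurger1995, §II.1.3, §II.1.10] [cite: DeitmarEchterhoff2014, Prop. 3.5.2] -/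
theorem exists_finset_heckeCharacter_family_decomposition_kType (hc : c * c = 1) {K' : Subgroup (quasiSplit F E c 2).Adelic}
    (hBK : ∃ W : Finset (quasiSplit F E c 2).Adelic, ∀ g, ∃ β ∈ borelAdelic F E c 2, ∃ w ∈ W, ∃ k ∈ K', g = β * w * k)
    {ω : ↥K' → ℂ} (hω : ∀ k : ↥K', ‖ω k‖ ≤ 1)
    (ψ : (quasiSplit F E c 2).Adelic → ℂ) (hψc : Continuous ψ)
    (hψU : ∀ (u : adelicUnipotent F E c 2) (g : (quasiSplit F E c 2).Adelic), ψ ((u : (quasiSplit F E c 2).Adelic) * g) = ψ g)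
    (hψB : ∀ b ∈ arithmeticBorel F E c 2, ∀ g : (quasiSplit F E c 2).Adelic, ψ ((b : (quasiSplit F E c 2).Adelic) * g) = ψ g)
    (hψK : ∀ (g : (quasiSplit F E c 2).Adelic) (k : K'), ψ (g * (k : (quasiSplit F E c 2).Adelic)) = ω k * ψ g)
    {a b : ℝ≥0} (ha : 0 < a) (hband : ∀ g, ψ g ≠ 0 → a ≤ borelHeight g ∧ borelHeight g ≤ b) (ε : ℝ) (hε : 0 < ε) :
    ∃ (s : Finset (HeckeCharacter E)) (coef : HeckeCharacter E → ℂ) (P : HeckeCharacter E → (quasiSplit F E c 2).Adelic → ℂ),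
      (∀ χ ∈ s, (∀ r : ℝ≥0ˣ, χ (posRealIdele E r) = 1) ∧ Continuous (P χ) ∧
        (∀ (g : (quasiSplit F E c 2).Adelic) (k : K'), P χ (g * (k : (quasiSplit F E c 2).Adelic)) = ω k * P χ g) ∧
        (∀ b ∈ arithmeticBorel F E c 2, ∀ g : (quasiSplit F E c 2).Adelic, P χ ((b : (quasiSplit F E c 2).Adelic) * g) = P χ g) ∧
        (∀ (b : (quasiSplit F E c 2).Adelic) (hb : b ∈ borelAdelic F E c 2), IdeleClassGroup.ideleNorm E (firstEntryUnit hb) = 1 →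
          ∀ g : (quasiSplit F E c 2).Adelic, P χ (b * g) = ((χ (firstEntryUnit hb) : ℂˣ) : ℂ) * P χ g) ∧
        (∀ g, P χ g ≠ 0 → a ≤ borelHeight g ∧ borelHeight g ≤ b) ∧ (∃ M : ℝ, ∀ g, ‖P χ g‖ ≤ M)) ∧
      ∀ g, ‖ψ g - ∑ χ ∈ s, coef χ * P χ g‖ ≤ ε := by
  classical
  haveI : T2Space (IdeleClassGroup E) := IdeleClassGroup.t2Space_ideleClassGroup_holds E
  haveI : CompactSpace ↥(IdeleClassGroup.normOne E) := compactSpace_normOne E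
  letI : MeasurableSpace ↥(IdeleClassGroup.normOne E) := borel _
  haveI : BorelSpace ↥(IdeleClassGroup.normOne E) := ⟨rfl⟩
  set μC : Measure ↥(IdeleClassGroup.normOne E) := Measure.haarMeasure ⊤ with hμC
  haveI : IsProbabilityMeasure μC :=
    ⟨by rw [hμC, ← TopologicalSpace.PositiveCompacts.coe_top]; exact Measure.haarMeasure_self⟩
  -- the section and the kernel (★ α-1; left data only, τ-generic)
  obtain ⟨σ, hσc, hσm, hσ₀, hσt⟩ := exists_torusSection_two (F := F) (E := E) (c := c) hc
  obtain ⟨Φ, hΦ, hΦc⟩ := exists_kernel hc hψc hψU hψB hσc hσm hσt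
  -- equicontinuity and a uniform bound (§1–§2, the ω-twins)
  obtain ⟨u, hu, h1u, hU⟩ := exists_isOpen_forall_kernel_sub_le_kType hψU hω hψK ha hband hBK hσm hσ₀ hσt hΦ hΦc (half_pos hε)
  obtain ⟨M, hM⟩ := exists_forall_norm_kernel_le_kType hψU hω hψK ha hband hBK hσm hσ₀ hσt hΦ hΦc
  -- Fejér for the family `(v, g) ↦ Φ(v, g)` on the compact abelian group `C_E¹` (★ α-2a)
  have hΦv : ∀ g : (quasiSplit F E c 2).Adelic, Continuous fun v : ↥(IdeleClassGroup.normOne E) => Φ (v : IdeleClassGroup E) g := fun g =>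
    hΦc.comp (continuous_subtype_val.prodMk continuous_const)
  have hU1 : ∀ v ∈ u, ∀ g : (quasiSplit F E c 2).Adelic,
      ‖Φ (v : IdeleClassGroup E) g - Φ ((1 : ↥(IdeleClassGroup.normOne E)) : IdeleClassGroup E) g‖ ≤ ε / 2 := fun v hv g => by
    have h := hU v hv ((1 : ↥(IdeleClassGroup.normOne E)) : IdeleClassGroup E) g
    rwa [← Subgroup.coe_mul, mul_one] at h
  obtain ⟨s₀, a₀, happrox⟩ := exists_finset_character_family_approx μC (Φ := fun (v : ↥(IdeleClassGroup.normOne E)) (g : (quasiSplit F E c 2).Adelic) => Φ (v : IdeleClassGroup E) g)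
    hΦv (fun v g => hM _ g) hε hu h1u hU1
  -- the dictionary `χ₀ ↦ χ` (★ α-0) and its injectivity
  choose hk hk_ray hk_val using fun χ₀ : PontryaginDual ↥(IdeleClassGroup.normOne E) =>
    exists_heckeCharacter_of_normOne_character E (χ₀ : ↥(IdeleClassGroup.normOne E) →ₜ* Circle)
  have hk_val' : ∀ (χ₀ : PontryaginDual ↥(IdeleClassGroup.normOne E)) (v : ↥(IdeleClassGroup.normOne E)) (x : ideleGroup E),
      (x : IdeleClassGroup E) = v → ((hk χ₀ x : ℂˣ) : ℂ) = ((χ₀ v : Circle) : ℂ) := fun χ₀ v x hx => by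
    obtain ⟨v, hv⟩ := v
    subst hx
    exact hk_val χ₀ x hv
  have hk_inj : Function.Injective hk := fun χ₁ χ₂ h => by
    refine PontryaginDual.ext fun v => Circle.ext ?_
    obtain ⟨x, hx⟩ := QuotientGroup.mk_surjective (v : IdeleClassGroup E)
    rw [← hk_val' χ₁ v x hx, ← hk_val' χ₂ v x hx, h]
  set ι : HeckeCharacter E → PontryaginDual ↥(IdeleClassGroup.normOne E) := Function.invFun hk with hιdef
  have hι : ∀ χ₀, ι (hk χ₀) = χ₀ := Function.leftInverse_invFun hk_inj
  refine ⟨s₀.image hk, fun χ => a₀ (ι χ), fun χ g => ∫ v, star (((ι χ) v : Circle) : ℂ) * Φ (v : IdeleClassGroup E) g ∂μC, fun χ hχ => ?_, fun g => ?_⟩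
  · obtain ⟨χ₀, hχ₀, rfl⟩ := Finset.mem_image.1 hχ
    simp only [hι]
    refine ⟨hk_ray χ₀, continuous_isotypicU μC hΦc χ₀, fun g k => ?_, fun β hβ g => ?_, fun β hβ h1 g => ?_, fun g hg => ?_, ⟨M, fun g => norm_isotypicU_le μC hM χ₀ g⟩⟩
    · exact isotypicU_mul_right_kType μC hψK hΦ χ₀ g k
    · simp_rw [kernel_rational_mul hψU hψB hΦ _ hβ]
    · have hv₀ : ((firstEntryUnit hβ : ideleGroup E) : IdeleClassGroup E) ∈ IdeleClassGroup.normOne E := by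
        rw [IdeleClassGroup.mem_normOne_iff, IdeleClassGroup.norm_mk, h1]
      simp_rw [kernel_borel_mul hψU hσm hσt hΦ _ hβ]
      rw [hk_val' χ₀ ⟨_, hv₀⟩ (firstEntryUnit hβ) rfl]
      exact isotypicU_mul_normOne μC Φ χ₀ ⟨_, hv₀⟩ g
    · obtain ⟨v, hv⟩ := exists_kernel_ne_zero_of_isotypicU_ne_zero μC hg
      have h := norm_mul_borelHeight_mem_of_kernel_ne_zero hband hσ₀ hΦ hv
      rwa [IdeleClassGroup.mem_normOne_iff.1 v.2, one_mul] at h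
  · rw [Finset.sum_image fun χ₁ _ χ₂ _ h => hk_inj h]
    simp only [hι]
    rw [← kernel_one_eq hσm hΦ g, ← OneMemClass.coe_one (IdeleClassGroup.normOne E)]
    exact happrox g

end Summit.HodgeConjecture.HodgeConjecture.Cruxes.H413.K2E1NormOneTorusFamilyApproxKTypeU2
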